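import Summits.HodgeConjecture.CorCM.IrreducibleOddWeightsSubfamilyDomination
import HarnessLib

/-!
# Sub-family domination, II: HODGE EQUIVALENCE — `MC₀ = MC₁` IFF `rank(Φ₀,Φ₁) = rank Φ₀ = rank Φ₁`; in an
# isotypic class IFF `D⟨b⟩ = D⟨b′⟩`; for single components domination is automatically MUTUAL

COR-CM (cell `pub-hodgecm2`, binder seat `b16` gen 74, count-neutral claim SUB-FAMILY DOMINATION AND HODGE
EQUIVALENCE, file S2 — abstract `G`-set level and type ranks; theorems only, no definition, no named fact, no
`sorry`).  NEW as stated, hence under `Summits/`.  HONEST FRAMING: finite-dimensional linear algebra about the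
Kubota–Dodson rank, read on Mumford–Tate groups of abelian varieties with complex multiplication.  Two slots `A₀`,
`A₁` are called here HODGE-EQUIVALENT when `MC₀ = MC₁` in `ℚ^G` (`X^*(MT(A₀))_ℚ = X^*(MT(A₁))_ℚ` on the generating
Galois orbit): both projections `MT(A₀ × A₁) → MT(A_i)` are isogenies, each of `A₀`, `A₁` is Hodge-dominated by the
other, their Hodge structures generate the same tensor category.  Nothing is claimed about the algebraicity of Hodge
classes; `HC_CM` is neither used nor asserted.

* §1 TWO SLOTS (no irreducibility): `typeRank_eq_of_span_coeff_eq` (`MC₀ = MC₁ ⟹ rank Φ₀ = rank Φ₁`);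
  **`span_coeff_eq_iff_le_and_typeRank_eq`: `MC₁ = MC₀ ⟺ MC₁ ≤ MC₀ ∧ rank Φ₁ = rank Φ₀`** (domination plus equal
  Hodge-group dimension); for a pair **`span_coeff_eq_iff_typeRank_sigmaType_eq_and_eq_of_pair`: `MC₁ = MC₀ ⟺
  rank(Φ₀,Φ₁) = rank Φ₀ ∧ rank(Φ₀,Φ₁) = rank Φ₁`** (file K3 twice); `span_coeff_eq_iff_typeRank_eq_of_dominated`.
* §2 TWO BLOCKS (file S1): **`iSup_span_coeff_eq_iff_typeRank_sigmaType_eq_and_eq_of_union`: `MC_q = MC_p ⟺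
  rank Σ|_{p∨q} = rank Σ|_p ∧ rank Σ|_{p∨q} = rank Σ|_q`**; `iSup_span_coeff_eq_iff_le_and_typeRank_sigmaType_eq`.
* §3 IN AN ISOTYPIC CLASS — both type vectors `u₀ = Σ_j ι⁰_j(b_j)`, `u₁ = Σ_k ι¹_k(b′_k)` assembled from ONE reference
  stable irreducible `A` (commutant `𝒟`, ANY) by equivariant, jointly independent embeddings (the Galois pivots of
  gen 72/73): `typeRank_mul_eq_of_class` (**`rank Φ·δ = δ + dim D⟨b⟩·dim A`**: `dim Hg(A_Φ) = dim_D D⟨b⟩ · dim A`),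
  `span_coeff_le_iff_iSup_le_of_class` (`MC₁ ≤ MC₀ ⟺ D⟨b′⟩ ≤ D⟨b⟩`), **`span_coeff_eq_iff_iSup_eq_of_class`:
  `MC₁ = MC₀ ⟺ D⟨b′⟩ = D⟨b⟩`**, `typeRank_eq_typeRank_iff_finrank_iSup_eq_of_class` (**`rank Φ₀ = rank Φ₁ ⟺
  dim D⟨b⟩ = dim D⟨b′⟩`**).
* §4 ONE COMPONENT PER SIDE (`u₀ = ι⁰(b)`, `u₁ = ι¹(b′)`, `b, b′ ≠ 0`): `span_coeff_eq_iff_map_applyₗ_eq_single`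
  (`MC₁ = MC₀ ⟺ D·b′ = D·b`), **`span_coeff_le_iff_span_coeff_eq_single`: `MC₁ ≤ MC₀ ⟺ MC₁ = MC₀`** — D-lines are
  equal or disjoint (gen 72 C1), so between two such slots HODGE DOMINATION IS AUTOMATICALLY MUTUAL; for a pair
  **`typeRank_sigmaType_eq_typeRank_iff_swap_single`: `rank(Φ₀,Φ₁) = rank Φ₀ ⟺ rank(Φ₀,Φ₁) = rank Φ₁`**.

## References

* [Deligne1982HodgeCycles] P. Deligne, *Hodge cycles on abelian varieties*, LNM 900 (1982), I.3.4, I.5 (p. 53),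
  I Ex. 3.7 (c).
* [Gordon1999HodgeAVSurvey] B. B. Gordon, *A survey of the Hodge conjecture for abelian varieties*, §3 Theorem (Imai,
  Murty) with proof, 7.5–7.7, 9.4.3.
* [Ribet1980] K. A. Ribet, *Division fields of abelian varieties with complex multiplication*, Mém. SMF 2 (1980),
  §3 (3.3).
* [Lang2002] S. Lang, *Algebra*, 3rd ed., XVII §1 Prop. 1.1 and §3.
* [CurtisReiner1962] C. W. Curtis, I. Reiner, *Representation Theory of Finite Groups and Associative Algebras*,
  §27 (27.3).
-/

set_option autoImplicit false

noncomputable section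

open scoped BigOperators Classical

universe u u₀ u₁ v vY w

namespace Summit.HodgeConjecture.CorCM.IrrOdd

open Literature.NumberTheory.ComplexMultiplication

variable {G : Type w} [Group G] {I : Type u} {E : I → Type v} [∀ i, MulAction G (E i)] [∀ i, Fintype (E i)]
  [Fintype I] [∀ i, Nonempty (E i)]

/-! ### §1 Two slots -/

omit [Fintype I] [∀ i, Nonempty (E i)] in
/-- `rank Φ_i = dim MC_i + 1` (`rank = dim U + 1`, gen 64 R1 `dim U = dim MC`). [cite: Ribet1980, §3 (3.3)]
[cite: Deligne1982HodgeCycles, I.3.4] -/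
private theorem typeRank_eq_finrank_span_coeff_add_one {ρ : G} {Φ : ∀ i, Set (E i)}
    (h : ∀ i, IsCMTypeWith ρ (Φ i)) (i : I) [Nonempty (E i)] :
    typeRank G (Φ i) =
      Module.finrank ℚ ↥(Submodule.span ℚ (Set.range fun x : E i => fun g : G => antiVec (Φ i) g x)) + 1 := by
  rw [(h i).typeRank_eq_finrank_antiSpan_add_one, finrank_antiSpan_eq_finrank_span_coeff]

omit [Fintype I] in
/-- **HODGE-EQUIVALENT slots have Hodge groups of the same dimension**: `MC₀ = MC₁ ⟹ rank Φ₀ = rank Φ₁`.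
[cite: Deligne1982HodgeCycles, I.3.4 and I.5 (p. 53)] [cite: Ribet1980, §3 (3.3)] -/
theorem typeRank_eq_of_span_coeff_eq {ρ : G} {Φ : ∀ i, Set (E i)} (h : ∀ i, IsCMTypeWith ρ (Φ i)) {i₀ i₁ : I}
    (heq : Submodule.span ℚ (Set.range fun x : E i₀ => fun g : G => antiVec (Φ i₀) g x) =
      Submodule.span ℚ (Set.range fun x : E i₁ => fun g : G => antiVec (Φ i₁) g x)) :
    typeRank G (Φ i₀) = typeRank G (Φ i₁) := by
  rw [typeRank_eq_finrank_span_coeff_add_one h i₀, typeRank_eq_finrank_span_coeff_add_one h i₁, heq]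

omit [Fintype I] in
/-- **`MC₁ = MC₀ ⟺ MC₁ ≤ MC₀ ∧ rank Φ₁ = rank Φ₀`**: Hodge equivalence is Hodge domination plus equality of the
dimensions of the Hodge groups (a subspace of the same finite dimension is the whole space).
[cite: Deligne1982HodgeCycles, I.5 (p. 53)] [cite: Gordon1999HodgeAVSurvey, §3 Theorem (proof), 7.7] -/
theorem span_coeff_eq_iff_le_and_typeRank_eq {ρ : G} {Φ : ∀ i, Set (E i)} (h : ∀ i, IsCMTypeWith ρ (Φ i))
    (i₀ i₁ : I) :
    Submodule.span ℚ (Set.range fun x : E i₁ => fun g : G => antiVec (Φ i₁) g x) =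
        Submodule.span ℚ (Set.range fun x : E i₀ => fun g : G => antiVec (Φ i₀) g x) ↔
      Submodule.span ℚ (Set.range fun x : E i₁ => fun g : G => antiVec (Φ i₁) g x) ≤
          Submodule.span ℚ (Set.range fun x : E i₀ => fun g : G => antiVec (Φ i₀) g x) ∧
        typeRank G (Φ i₁) = typeRank G (Φ i₀) := by
  haveI := fun i => finite_span_coeff (G := G) (Φ i)
  refine ⟨fun heq => ⟨heq.le, typeRank_eq_of_span_coeff_eq h heq⟩, fun ⟨hle, hrk⟩ => ?_⟩
  rw [typeRank_eq_finrank_span_coeff_add_one h i₁, typeRank_eq_finrank_span_coeff_add_one h i₀,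
    Nat.add_right_cancel_iff] at hrk
  exact Submodule.eq_of_le_of_finrank_eq hle hrk

/-- **HODGE EQUIVALENCE OF A PAIR: `MC₁ = MC₀ ⟺ rank(Φ₀,Φ₁) = rank Φ₀ ∧ rank(Φ₀,Φ₁) = rank Φ₁`** — both
projections `MT(A₀ × A₁) → MT(A_i)` are isogenies (file K3's domination both ways).
[cite: Deligne1982HodgeCycles, I.5 (p. 53)] [cite: Gordon1999HodgeAVSurvey, §3 Theorem (proof), 7.5–7.7] -/
theorem span_coeff_eq_iff_typeRank_sigmaType_eq_and_eq_of_pair {ρ : G} {Φ : ∀ i, Set (E i)}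
    (h : ∀ i, IsCMTypeWith ρ (Φ i)) {i₀ i₁ : I} (hI : ∀ j, j = i₀ ∨ j = i₁) :
    Submodule.span ℚ (Set.range fun x : E i₁ => fun g : G => antiVec (Φ i₁) g x) =
        Submodule.span ℚ (Set.range fun x : E i₀ => fun g : G => antiVec (Φ i₀) g x) ↔
      typeRank G (sigmaType Φ) = typeRank G (Φ i₀) ∧ typeRank G (sigmaType Φ) = typeRank G (Φ i₁) := by
  have hI' : ∀ j, j = i₁ ∨ j = i₀ := fun j => (hI j).symm
  rw [typeRank_sigmaType_eq_typeRank_iff_span_coeff_le_of_pair h hI,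
    typeRank_sigmaType_eq_typeRank_iff_span_coeff_le_of_pair h hI', le_antisymm_iff]

/-- **Under domination, equal dimension is equivalence**: if `rank(Φ₀,Φ₁) = rank Φ₀` (`A₁` Hodge-dominated by
`A₀`), then `rank Φ₁ = rank Φ₀ ⟺ MC₁ = MC₀`. [cite: Deligne1982HodgeCycles, I.5 (p. 53)]
[cite: Gordon1999HodgeAVSurvey, §3 Theorem (proof), 7.7] -/
theorem span_coeff_eq_iff_typeRank_eq_of_dominated {ρ : G} {Φ : ∀ i, Set (E i)}
    (h : ∀ i, IsCMTypeWith ρ (Φ i)) {i₀ i₁ : I} (hI : ∀ j, j = i₀ ∨ j = i₁)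
    (hdom : typeRank G (sigmaType Φ) = typeRank G (Φ i₀)) :
    Submodule.span ℚ (Set.range fun x : E i₁ => fun g : G => antiVec (Φ i₁) g x) =
        Submodule.span ℚ (Set.range fun x : E i₀ => fun g : G => antiVec (Φ i₀) g x) ↔
      typeRank G (Φ i₁) = typeRank G (Φ i₀) := by
  rw [span_coeff_eq_iff_le_and_typeRank_eq h i₀ i₁]
  exact ⟨fun hh => hh.2, fun hrk => ⟨(typeRank_sigmaType_eq_typeRank_iff_span_coeff_le_of_pair h hI).1 hdom, hrk⟩⟩

/-! ### §2 Two blocks -/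

omit [∀ i, Nonempty (E i)] in
/-- **HODGE-EQUIVALENT BLOCKS: `MC_q = MC_p ⟺ rank Σ|_{p∨q} = rank Σ|_p ∧ rank Σ|_{p∨q} = rank Σ|_q`** — both
projections `MT(∏_{p∪q} A_i) → MT(∏_p A_i)`, `→ MT(∏_q A_i)` are isogenies (file S1's block domination both ways).
[cite: Deligne1982HodgeCycles, I.5 (p. 53)] [cite: Gordon1999HodgeAVSurvey, §3 Theorem (proof), 7.5–7.7] -/
theorem iSup_span_coeff_eq_iff_typeRank_sigmaType_eq_and_eq_of_union {ρ : G} {Φ : ∀ i, Set (E i)}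
    (h : ∀ i, IsCMTypeWith ρ (Φ i)) (p q r : I → Prop) (hr : ∀ i, r i ↔ p i ∨ q i)
    [Nonempty (Σ j : {i // p i}, E j.1)] [Nonempty (Σ j : {i // q i}, E j.1)] :
    (⨆ j : {i // q i}, Submodule.span ℚ (Set.range fun x : E j.1 => fun g : G => antiVec (Φ j.1) g x)) =
        (⨆ j : {i // p i}, Submodule.span ℚ (Set.range fun x : E j.1 => fun g : G => antiVec (Φ j.1) g x)) ↔
      typeRank G (sigmaType fun j : {i // r i} => Φ j.1) = typeRank G (sigmaType fun j : {i // p i} => Φ j.1) ∧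
        typeRank G (sigmaType fun j : {i // r i} => Φ j.1) = typeRank G (sigmaType fun j : {i // q i} => Φ j.1) := by
  have hr' : ∀ i, r i ↔ q i ∨ p i := fun i => (hr i).trans Or.comm
  rw [typeRank_sigmaType_eq_iff_iSup_span_coeff_le_of_union h p q r hr,
    typeRank_sigmaType_eq_iff_iSup_span_coeff_le_of_union h q p r hr', le_antisymm_iff]

omit [∀ i, Nonempty (E i)] in
/-- **`MC_q = MC_p ⟺ MC_q ≤ MC_p ∧ rank Σ|_q = rank Σ|_p`** (blocks: domination plus equal Hodge-group dimension).
[cite: Deligne1982HodgeCycles, I.5 (p. 53)] [cite: Gordon1999HodgeAVSurvey, §3 Theorem (proof), 7.7] -/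
theorem iSup_span_coeff_eq_iff_le_and_typeRank_sigmaType_eq {ρ : G} {Φ : ∀ i, Set (E i)}
    (h : ∀ i, IsCMTypeWith ρ (Φ i)) (p q : I → Prop)
    [Nonempty (Σ j : {i // p i}, E j.1)] [Nonempty (Σ j : {i // q i}, E j.1)] :
    (⨆ j : {i // q i}, Submodule.span ℚ (Set.range fun x : E j.1 => fun g : G => antiVec (Φ j.1) g x)) =
        (⨆ j : {i // p i}, Submodule.span ℚ (Set.range fun x : E j.1 => fun g : G => antiVec (Φ j.1) g x)) ↔
      (⨆ j : {i // q i}, Submodule.span ℚ (Set.range fun x : E j.1 => fun g : G => antiVec (Φ j.1) g x)) ≤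
          (⨆ j : {i // p i}, Submodule.span ℚ (Set.range fun x : E j.1 => fun g : G => antiVec (Φ j.1) g x)) ∧
        typeRank G (sigmaType fun j : {i // q i} => Φ j.1) = typeRank G (sigmaType fun j : {i // p i} => Φ j.1) := by
  have hp := typeRank_sigmaType_subtype_eq_finrank_iSup_add_one h p
  have hq := typeRank_sigmaType_subtype_eq_finrank_iSup_add_one h q
  set C : I → Submodule ℚ (G → ℚ) := fun i =>
    Submodule.span ℚ (Set.range fun x : E i => fun g : G => antiVec (Φ i) g x) with hC
  change _ = Module.finrank ℚ ↥(⨆ j : {i // p i}, C j.1) + 1 at hp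
  change _ = Module.finrank ℚ ↥(⨆ j : {i // q i}, C j.1) + 1 at hq
  change (⨆ j : {i // q i}, C j.1) = (⨆ j : {i // p i}, C j.1) ↔
    (⨆ j : {i // q i}, C j.1) ≤ (⨆ j : {i // p i}, C j.1) ∧ _
  haveI : ∀ i, Module.Finite ℚ ↥(C i) := fun i => finite_span_coeff (G := G) (Φ i)
  haveI : Module.Finite ℚ ↥(⨆ j : {i // p i}, C j.1) := Submodule.finite_iSup _
  refine ⟨fun heq => ⟨heq.le, by rw [hp, hq, heq]⟩, fun ⟨hle, hrk⟩ => ?_⟩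
  rw [hp, hq, Nat.add_right_cancel_iff] at hrk
  exact Submodule.eq_of_le_of_finrank_eq hle hrk

/-! ### §3 In an isotypic class: both type vectors from one reference irreducible -/

section Class

variable {Y : Type vY} [MulAction G Y] [Fintype Y]

omit [Fintype I] in
/-- **THE HODGE GROUP OF ONE SLOT IN A CLASS: `rank Φ·δ = δ + dim D⟨b⟩·dim A`**, i.e. `dim Hg(A_Φ)·δ =
dim D⟨b⟩·dim A` for the type vector `u = Σ_j ι_j(b_j)` assembled from the reference irreducible `A` (gen 72 C4's count
`dim S(u)·δ = dim D⟨b⟩·dim A` with `MC = S(u)`). [cite: Lang2002, XVII §3] [cite: Ribet1980, §3 (3.3)]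
[cite: Deligne1982HodgeCycles, I.3.4] -/
theorem typeRank_mul_eq_of_class {ρ : G} {Φ : ∀ i, Set (E i)} (h : ∀ i, IsCMTypeWith ρ (Φ i)) (i₀ : I)
    {A : Submodule ℚ (Y → ℚ)} {𝒟 : Submodule ℚ ((Y → ℚ) →ₗ[ℚ] (Y → ℚ))}
    (h𝒟 : ∀ L : (Y → ℚ) →ₗ[ℚ] (Y → ℚ), L ∈ 𝒟 ↔ (∀ a ∈ A, L a ∈ A) ∧
      ∀ (k : G) (a : Y → ℚ), a ∈ A → L (fun y => a (k • y)) = fun y => L a (k • y))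
    (hAst : ∀ (k : G) (a : Y → ℚ), a ∈ A → (fun y => a (k • y)) ∈ A)
    (hAirr : ∀ W : Submodule ℚ (Y → ℚ), W ≤ A → W ≠ ⊥ →
      (∀ (k : G) (f : Y → ℚ), f ∈ W → (fun y => f (k • y)) ∈ W) → W = A)
    {J₀ : Type u₀} [Fintype J₀] (ι₀ : J₀ → ((Y → ℚ) →ₗ[ℚ] (E i₀ → ℚ)))
    (hι₀eq : ∀ (j : J₀) (k : G) (a : Y → ℚ), a ∈ A → ι₀ j (fun y => a (k • y)) = fun y => ι₀ j a (k • y))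
    (hind₀ : ∀ f : J₀ → (Y → ℚ), (∀ j, f j ∈ A) → ∑ j, ι₀ j (f j) = 0 → ∀ j, f j = 0)
    {b₀ : J₀ → (Y → ℚ)} (hb₀ : ∀ j, b₀ j ∈ A) (hu₀ : antiVec (Φ i₀) (1 : G) = ∑ j, ι₀ j (b₀ j))
    {a₀ : Y → ℚ} (ha₀ : a₀ ∈ A) (h0 : a₀ ≠ 0) :
    typeRank G (Φ i₀) * Module.finrank ℚ ↥(𝒟.map (LinearMap.applyₗ a₀)) =
      Module.finrank ℚ ↥(𝒟.map (LinearMap.applyₗ a₀)) +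
        Module.finrank ℚ ↥(⨆ j, 𝒟.map (LinearMap.applyₗ (b₀ j))) * Module.finrank ℚ A := by
  rw [typeRank_eq_finrank_span_coeff_add_one h i₀, span_coeff_eq_span_shadowCoeff_of_eq Φ i₀ hu₀, add_mul, one_mul,
    finrank_span_shadowCoeff_sum_mul_eq (Y₀ := E i₀) h𝒟 hAst hAirr ι₀ hι₀eq hind₀ hb₀ ha₀ h0, add_comm]

omit [Fintype I] [∀ i, Nonempty (E i)] in
/-- **`MC₁ ≤ MC₀ ⟺ D⟨b′⟩ ≤ D⟨b⟩`** on the Galois pivots of both slots: `A₁` is Hodge-dominated by `A₀` iff the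
components of `u₁` are `D`-combinations of those of `u₀` (gen 72 C6's absorption; `A ≠ 0`).
[cite: Lang2002, XVII §3] [cite: Gordon1999HodgeAVSurvey, §3 Theorem (proof), 7.5–7.7] -/
theorem span_coeff_le_iff_iSup_le_of_class (Φ : ∀ i, Set (E i)) (i₀ i₁ : I)
    {A : Submodule ℚ (Y → ℚ)} {𝒟 : Submodule ℚ ((Y → ℚ) →ₗ[ℚ] (Y → ℚ))}
    (h𝒟 : ∀ L : (Y → ℚ) →ₗ[ℚ] (Y → ℚ), L ∈ 𝒟 ↔ (∀ a ∈ A, L a ∈ A) ∧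
      ∀ (k : G) (a : Y → ℚ), a ∈ A → L (fun y => a (k • y)) = fun y => L a (k • y))
    (hAst : ∀ (k : G) (a : Y → ℚ), a ∈ A → (fun y => a (k • y)) ∈ A)
    (hAirr : ∀ W : Submodule ℚ (Y → ℚ), W ≤ A → W ≠ ⊥ →
      (∀ (k : G) (f : Y → ℚ), f ∈ W → (fun y => f (k • y)) ∈ W) → W = A)
    (hA0 : A ≠ ⊥) {J₀ : Type u₀} {J₁ : Type u₁} [Fintype J₀] [Fintype J₁]
    (ι₀ : J₀ → ((Y → ℚ) →ₗ[ℚ] (E i₀ → ℚ))) (ι₁ : J₁ → ((Y → ℚ) →ₗ[ℚ] (E i₁ → ℚ)))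
    (hι₀eq : ∀ (j : J₀) (k : G) (a : Y → ℚ), a ∈ A → ι₀ j (fun y => a (k • y)) = fun y => ι₀ j a (k • y))
    (hι₁eq : ∀ (j : J₁) (k : G) (a : Y → ℚ), a ∈ A → ι₁ j (fun y => a (k • y)) = fun y => ι₁ j a (k • y))
    (hind₀ : ∀ f : J₀ → (Y → ℚ), (∀ j, f j ∈ A) → ∑ j, ι₀ j (f j) = 0 → ∀ j, f j = 0)
    (hind₁ : ∀ f : J₁ → (Y → ℚ), (∀ j, f j ∈ A) → ∑ j, ι₁ j (f j) = 0 → ∀ j, f j = 0)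
    {b₀ : J₀ → (Y → ℚ)} {b₁ : J₁ → (Y → ℚ)} (hb₀ : ∀ j, b₀ j ∈ A) (hb₁ : ∀ j, b₁ j ∈ A)
    (hu₀ : antiVec (Φ i₀) (1 : G) = ∑ j, ι₀ j (b₀ j)) (hu₁ : antiVec (Φ i₁) (1 : G) = ∑ j, ι₁ j (b₁ j)) :
    Submodule.span ℚ (Set.range fun x : E i₁ => fun g : G => antiVec (Φ i₁) g x) ≤
        Submodule.span ℚ (Set.range fun x : E i₀ => fun g : G => antiVec (Φ i₀) g x) ↔
      (⨆ j, 𝒟.map (LinearMap.applyₗ (b₁ j))) ≤ ⨆ j, 𝒟.map (LinearMap.applyₗ (b₀ j)) := by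
  rw [span_coeff_eq_span_shadowCoeff_of_eq Φ i₀ hu₀, span_coeff_eq_span_shadowCoeff_of_eq Φ i₁ hu₁]
  exact span_shadowCoeff_le_iff_iSup_le h𝒟 hAst hAirr hA0 ι₀ ι₁ hι₀eq hι₁eq hind₀ hind₁ hb₀ hb₁

omit [Fintype I] [∀ i, Nonempty (E i)] in
/-- **HODGE EQUIVALENCE IN A CLASS: `MC₁ = MC₀ ⟺ D⟨b′⟩ = D⟨b⟩`** — two slots of one isotypic class are
Hodge-equivalent iff the components of their type vectors span the same `D`-submodule of the reference irreducible
(`A ≠ 0`). [cite: Lang2002, XVII §3] [cite: Gordon1999HodgeAVSurvey, §3 Theorem (proof), 7.5–7.7 and 9.4.3] -/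
theorem span_coeff_eq_iff_iSup_eq_of_class (Φ : ∀ i, Set (E i)) (i₀ i₁ : I)
    {A : Submodule ℚ (Y → ℚ)} {𝒟 : Submodule ℚ ((Y → ℚ) →ₗ[ℚ] (Y → ℚ))}
    (h𝒟 : ∀ L : (Y → ℚ) →ₗ[ℚ] (Y → ℚ), L ∈ 𝒟 ↔ (∀ a ∈ A, L a ∈ A) ∧
      ∀ (k : G) (a : Y → ℚ), a ∈ A → L (fun y => a (k • y)) = fun y => L a (k • y))
    (hAst : ∀ (k : G) (a : Y → ℚ), a ∈ A → (fun y => a (k • y)) ∈ A)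
    (hAirr : ∀ W : Submodule ℚ (Y → ℚ), W ≤ A → W ≠ ⊥ →
      (∀ (k : G) (f : Y → ℚ), f ∈ W → (fun y => f (k • y)) ∈ W) → W = A)
    (hA0 : A ≠ ⊥) {J₀ : Type u₀} {J₁ : Type u₁} [Fintype J₀] [Fintype J₁]
    (ι₀ : J₀ → ((Y → ℚ) →ₗ[ℚ] (E i₀ → ℚ))) (ι₁ : J₁ → ((Y → ℚ) →ₗ[ℚ] (E i₁ → ℚ)))
    (hι₀eq : ∀ (j : J₀) (k : G) (a : Y → ℚ), a ∈ A → ι₀ j (fun y => a (k • y)) = fun y => ι₀ j a (k • y))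
    (hι₁eq : ∀ (j : J₁) (k : G) (a : Y → ℚ), a ∈ A → ι₁ j (fun y => a (k • y)) = fun y => ι₁ j a (k • y))
    (hind₀ : ∀ f : J₀ → (Y → ℚ), (∀ j, f j ∈ A) → ∑ j, ι₀ j (f j) = 0 → ∀ j, f j = 0)
    (hind₁ : ∀ f : J₁ → (Y → ℚ), (∀ j, f j ∈ A) → ∑ j, ι₁ j (f j) = 0 → ∀ j, f j = 0)
    {b₀ : J₀ → (Y → ℚ)} {b₁ : J₁ → (Y → ℚ)} (hb₀ : ∀ j, b₀ j ∈ A) (hb₁ : ∀ j, b₁ j ∈ A)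
    (hu₀ : antiVec (Φ i₀) (1 : G) = ∑ j, ι₀ j (b₀ j)) (hu₁ : antiVec (Φ i₁) (1 : G) = ∑ j, ι₁ j (b₁ j)) :
    Submodule.span ℚ (Set.range fun x : E i₁ => fun g : G => antiVec (Φ i₁) g x) =
        Submodule.span ℚ (Set.range fun x : E i₀ => fun g : G => antiVec (Φ i₀) g x) ↔
      (⨆ j, 𝒟.map (LinearMap.applyₗ (b₁ j))) = ⨆ j, 𝒟.map (LinearMap.applyₗ (b₀ j)) := by
  rw [span_coeff_eq_span_shadowCoeff_of_eq Φ i₀ hu₀, span_coeff_eq_span_shadowCoeff_of_eq Φ i₁ hu₁]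
  exact span_shadowCoeff_eq_iff_iSup_eq h𝒟 hAst hAirr hA0 ι₀ ι₁ hι₀eq hι₁eq hind₀ hind₁ hb₀ hb₁

omit [Fintype I] in
/-- **EQUAL HODGE-GROUP DIMENSION IN A CLASS: `rank Φ₀ = rank Φ₁ ⟺ dim D⟨b⟩ = dim D⟨b′⟩`** (`A ≠ 0`): both are
`1 + dim_D(D-span of the components)·dim A`. [cite: Lang2002, XVII §3] [cite: Ribet1980, §3 (3.3)] -/
theorem typeRank_eq_typeRank_iff_finrank_iSup_eq_of_class {ρ : G} {Φ : ∀ i, Set (E i)}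
    (h : ∀ i, IsCMTypeWith ρ (Φ i)) (i₀ i₁ : I)
    {A : Submodule ℚ (Y → ℚ)} {𝒟 : Submodule ℚ ((Y → ℚ) →ₗ[ℚ] (Y → ℚ))}
    (h𝒟 : ∀ L : (Y → ℚ) →ₗ[ℚ] (Y → ℚ), L ∈ 𝒟 ↔ (∀ a ∈ A, L a ∈ A) ∧
      ∀ (k : G) (a : Y → ℚ), a ∈ A → L (fun y => a (k • y)) = fun y => L a (k • y))
    (hAst : ∀ (k : G) (a : Y → ℚ), a ∈ A → (fun y => a (k • y)) ∈ A)
    (hAirr : ∀ W : Submodule ℚ (Y → ℚ), W ≤ A → W ≠ ⊥ →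
      (∀ (k : G) (f : Y → ℚ), f ∈ W → (fun y => f (k • y)) ∈ W) → W = A)
    (hA0 : A ≠ ⊥) {J₀ : Type u₀} {J₁ : Type u₁} [Fintype J₀] [Fintype J₁]
    (ι₀ : J₀ → ((Y → ℚ) →ₗ[ℚ] (E i₀ → ℚ))) (ι₁ : J₁ → ((Y → ℚ) →ₗ[ℚ] (E i₁ → ℚ)))
    (hι₀eq : ∀ (j : J₀) (k : G) (a : Y → ℚ), a ∈ A → ι₀ j (fun y => a (k • y)) = fun y => ι₀ j a (k • y))
    (hι₁eq : ∀ (j : J₁) (k : G) (a : Y → ℚ), a ∈ A → ι₁ j (fun y => a (k • y)) = fun y => ι₁ j a (k • y))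
    (hind₀ : ∀ f : J₀ → (Y → ℚ), (∀ j, f j ∈ A) → ∑ j, ι₀ j (f j) = 0 → ∀ j, f j = 0)
    (hind₁ : ∀ f : J₁ → (Y → ℚ), (∀ j, f j ∈ A) → ∑ j, ι₁ j (f j) = 0 → ∀ j, f j = 0)
    {b₀ : J₀ → (Y → ℚ)} {b₁ : J₁ → (Y → ℚ)} (hb₀ : ∀ j, b₀ j ∈ A) (hb₁ : ∀ j, b₁ j ∈ A)
    (hu₀ : antiVec (Φ i₀) (1 : G) = ∑ j, ι₀ j (b₀ j)) (hu₁ : antiVec (Φ i₁) (1 : G) = ∑ j, ι₁ j (b₁ j)) :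
    typeRank G (Φ i₀) = typeRank G (Φ i₁) ↔
      Module.finrank ℚ ↥(⨆ j, 𝒟.map (LinearMap.applyₗ (b₀ j))) =
        Module.finrank ℚ ↥(⨆ j, 𝒟.map (LinearMap.applyₗ (b₁ j))) := by
  obtain ⟨a₀, ha₀, h0⟩ := Submodule.exists_mem_ne_zero_of_ne_bot hA0
  have h₀ := typeRank_mul_eq_of_class h i₀ h𝒟 hAst hAirr ι₀ hι₀eq hind₀ hb₀ hu₀ ha₀ h0
  have h₁ := typeRank_mul_eq_of_class h i₁ h𝒟 hAst hAirr ι₁ hι₁eq hind₁ hb₁ hu₁ ha₀ h0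
  let T : G → (Y → ℚ) →ₗ[ℚ] (Y → ℚ) := fun k => LinearMap.funLeft ℚ ℚ (fun y : Y => k • y)
  haveI : FiniteDimensional ℚ A := Submodule.finiteDimensional_of_le le_top
  have hA : 0 < Module.finrank ℚ A :=
    Nat.pos_of_ne_zero fun h' => hA0 (Submodule.finrank_eq_zero.1 h')
  haveI : FiniteDimensional ℚ ↥(𝒟.map (LinearMap.applyₗ a₀)) :=
    Submodule.finiteDimensional_of_le (map_applyₗ_le T (A := A) (fun L => h𝒟 L) ha₀)
  have hδ : 0 < Module.finrank ℚ ↥(𝒟.map (LinearMap.applyₗ a₀)) :=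
    Nat.pos_of_ne_zero fun h' => map_applyₗ_ne_bot T (A := A) (fun L => h𝒟 L) h0 (Submodule.finrank_eq_zero.1 h')
  constructor
  · intro hrk
    rw [hrk, h₁] at h₀
    exact (Nat.eq_of_mul_eq_mul_right hA (Nat.add_left_cancel h₀)).symm
  · intro hdim
    rw [hdim, ← h₁] at h₀
    exact Nat.eq_of_mul_eq_mul_right hδ h₀

/-! ### §4 One component per side: domination is automatically mutual -/

omit [Fintype I] [∀ i, Nonempty (E i)] in
/-- **`MC₁ = MC₀ ⟺ D·b′ = D·b`** for single-component type vectors `u₀ = ι⁰(b)`, `u₁ = ι¹(b′)` (equivariant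
embeddings injective on `A ≠ 0`). [cite: Lang2002, XVII §1 Prop. 1.1 and §3] [cite: CurtisReiner1962, §27 (27.3)] -/
theorem span_coeff_eq_iff_map_applyₗ_eq_single (Φ : ∀ i, Set (E i)) (i₀ i₁ : I)
    {A : Submodule ℚ (Y → ℚ)} {𝒟 : Submodule ℚ ((Y → ℚ) →ₗ[ℚ] (Y → ℚ))}
    (h𝒟 : ∀ L : (Y → ℚ) →ₗ[ℚ] (Y → ℚ), L ∈ 𝒟 ↔ (∀ a ∈ A, L a ∈ A) ∧
      ∀ (k : G) (a : Y → ℚ), a ∈ A → L (fun y => a (k • y)) = fun y => L a (k • y))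
    (hAst : ∀ (k : G) (a : Y → ℚ), a ∈ A → (fun y => a (k • y)) ∈ A)
    (hAirr : ∀ W : Submodule ℚ (Y → ℚ), W ≤ A → W ≠ ⊥ →
      (∀ (k : G) (f : Y → ℚ), f ∈ W → (fun y => f (k • y)) ∈ W) → W = A)
    (hA0 : A ≠ ⊥) (ι₀ : (Y → ℚ) →ₗ[ℚ] (E i₀ → ℚ)) (ι₁ : (Y → ℚ) →ₗ[ℚ] (E i₁ → ℚ))
    (hι₀eq : ∀ (k : G) (a : Y → ℚ), a ∈ A → ι₀ (fun y => a (k • y)) = fun y => ι₀ a (k • y))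
    (hι₁eq : ∀ (k : G) (a : Y → ℚ), a ∈ A → ι₁ (fun y => a (k • y)) = fun y => ι₁ a (k • y))
    (hinj₀ : ∀ f ∈ A, ι₀ f = 0 → f = 0) (hinj₁ : ∀ f ∈ A, ι₁ f = 0 → f = 0)
    {b₀ b₁ : Y → ℚ} (hb₀ : b₀ ∈ A) (hb₁ : b₁ ∈ A)
    (hu₀ : antiVec (Φ i₀) (1 : G) = ι₀ b₀) (hu₁ : antiVec (Φ i₁) (1 : G) = ι₁ b₁) :
    Submodule.span ℚ (Set.range fun x : E i₁ => fun g : G => antiVec (Φ i₁) g x) =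
        Submodule.span ℚ (Set.range fun x : E i₀ => fun g : G => antiVec (Φ i₀) g x) ↔
      𝒟.map (LinearMap.applyₗ b₁) = 𝒟.map (LinearMap.applyₗ b₀) := by
  rw [span_coeff_eq_span_shadowCoeff_of_eq Φ i₀ hu₀, span_coeff_eq_span_shadowCoeff_of_eq Φ i₁ hu₁]
  exact span_shadowCoeff_eq_iff_map_applyₗ_eq_single h𝒟 hAst hAirr hA0 ι₀ ι₁ hι₀eq hι₁eq hinj₀ hinj₁ hb₀ hb₁

omit [Fintype I] [∀ i, Nonempty (E i)] in
/-- **FOR SINGLE COMPONENTS, HODGE DOMINATION IS AUTOMATICALLY MUTUAL: `MC₁ ≤ MC₀ ⟺ MC₁ = MC₀`** (`u₀ = ι⁰(b)`,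
`u₁ = ι¹(b′)` with `b, b′ ≠ 0`): `MC₁ ≤ MC₀` says `b′ ∈ D·b` (gen 72 C6), and D-lines are EQUAL OR DISJOINT (gen 72
C1, Schur), so `D·b′ = D·b`. [cite: Lang2002, XVII §1 Prop. 1.1] [cite: CurtisReiner1962, §27 (27.3)]
[cite: Gordon1999HodgeAVSurvey, §3 Theorem (proof), 7.5–7.7] -/
theorem span_coeff_le_iff_span_coeff_eq_single (Φ : ∀ i, Set (E i)) (i₀ i₁ : I)
    {A : Submodule ℚ (Y → ℚ)} {𝒟 : Submodule ℚ ((Y → ℚ) →ₗ[ℚ] (Y → ℚ))}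
    (h𝒟 : ∀ L : (Y → ℚ) →ₗ[ℚ] (Y → ℚ), L ∈ 𝒟 ↔ (∀ a ∈ A, L a ∈ A) ∧
      ∀ (k : G) (a : Y → ℚ), a ∈ A → L (fun y => a (k • y)) = fun y => L a (k • y))
    (hAst : ∀ (k : G) (a : Y → ℚ), a ∈ A → (fun y => a (k • y)) ∈ A)
    (hAirr : ∀ W : Submodule ℚ (Y → ℚ), W ≤ A → W ≠ ⊥ →
      (∀ (k : G) (f : Y → ℚ), f ∈ W → (fun y => f (k • y)) ∈ W) → W = A)
    (ι₀ : (Y → ℚ) →ₗ[ℚ] (E i₀ → ℚ)) (ι₁ : (Y → ℚ) →ₗ[ℚ] (E i₁ → ℚ))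
    (hι₀eq : ∀ (k : G) (a : Y → ℚ), a ∈ A → ι₀ (fun y => a (k • y)) = fun y => ι₀ a (k • y))
    (hι₁eq : ∀ (k : G) (a : Y → ℚ), a ∈ A → ι₁ (fun y => a (k • y)) = fun y => ι₁ a (k • y))
    (hinj₀ : ∀ f ∈ A, ι₀ f = 0 → f = 0) (hinj₁ : ∀ f ∈ A, ι₁ f = 0 → f = 0)
    {b₀ b₁ : Y → ℚ} (hb₀ : b₀ ∈ A) (hb₁ : b₁ ∈ A) (hb₀0 : b₀ ≠ 0) (hb₁0 : b₁ ≠ 0)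
    (hu₀ : antiVec (Φ i₀) (1 : G) = ι₀ b₀) (hu₁ : antiVec (Φ i₁) (1 : G) = ι₁ b₁) :
    Submodule.span ℚ (Set.range fun x : E i₁ => fun g : G => antiVec (Φ i₁) g x) ≤
        Submodule.span ℚ (Set.range fun x : E i₀ => fun g : G => antiVec (Φ i₀) g x) ↔
      Submodule.span ℚ (Set.range fun x : E i₁ => fun g : G => antiVec (Φ i₁) g x) =
        Submodule.span ℚ (Set.range fun x : E i₀ => fun g : G => antiVec (Φ i₀) g x) := by
  have hA0 : A ≠ ⊥ := fun hbot => hb₀0 ((Submodule.mem_bot ℚ).1 (hbot ▸ hb₀))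
  refine ⟨fun hle => ?_, fun heq => heq.le⟩
  rw [span_coeff_eq_iff_map_applyₗ_eq_single Φ i₀ i₁ h𝒟 hAst hAirr hA0 ι₀ ι₁ hι₀eq hι₁eq hinj₀ hinj₁ hb₀ hb₁ hu₀ hu₁]
  rw [span_coeff_eq_span_shadowCoeff_of_eq Φ i₀ hu₀, span_coeff_eq_span_shadowCoeff_of_eq Φ i₁ hu₁,
    span_shadowCoeff_le_iff_mem_single h𝒟 hAst hAirr hA0 ι₀ ι₁ hι₀eq hι₁eq hinj₀ hinj₁ hb₀ hb₁] at hle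
  -- `b′ ∈ D·b`, `b′ ≠ 0`, and D-lines are equal or disjoint
  let T : G → (Y → ℚ) →ₗ[ℚ] (Y → ℚ) := fun k => LinearMap.funLeft ℚ ℚ (fun y : Y => k • y)
  haveI : FiniteDimensional ℚ A := Submodule.finiteDimensional_of_le le_top
  rcases map_applyₗ_eq_or_inf_eq_bot T (𝒟 := 𝒟) (A := A) (fun L => h𝒟 L) (fun k a ha => hAst k a ha)
      (fun W hW hW0 hWst => hAirr W hW hW0 fun k f hf => hWst k f hf) hb₁ hb₀ with heq | hbot
  · exact heq
  · exfalso
    have hmem : b₁ ∈ 𝒟.map (LinearMap.applyₗ b₁) ⊓ 𝒟.map (LinearMap.applyₗ b₀) :=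
      ⟨self_mem_map_applyₗ T (A := A) (fun L => h𝒟 L) b₁, hle⟩
    rw [hbot, Submodule.mem_bot] at hmem
    exact hb₁0 hmem

/-- **For a pair with single components: `rank(Φ₀,Φ₁) = rank Φ₀ ⟺ rank(Φ₀,Φ₁) = rank Φ₁`** — `A₁` is
Hodge-dominated by `A₀` iff `A₀` is Hodge-dominated by `A₁` iff they are Hodge-equivalent (`b, b′ ≠ 0` on one D-line).
[cite: Gordon1999HodgeAVSurvey, §3 Theorem (proof), 7.5–7.7] [cite: Lang2002, XVII §1 Prop. 1.1] -/
theorem typeRank_sigmaType_eq_typeRank_iff_swap_single {ρ : G} {Φ : ∀ i, Set (E i)}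
    (h : ∀ i, IsCMTypeWith ρ (Φ i)) {i₀ i₁ : I} (hI : ∀ j, j = i₀ ∨ j = i₁)
    {A : Submodule ℚ (Y → ℚ)} {𝒟 : Submodule ℚ ((Y → ℚ) →ₗ[ℚ] (Y → ℚ))}
    (h𝒟 : ∀ L : (Y → ℚ) →ₗ[ℚ] (Y → ℚ), L ∈ 𝒟 ↔ (∀ a ∈ A, L a ∈ A) ∧
      ∀ (k : G) (a : Y → ℚ), a ∈ A → L (fun y => a (k • y)) = fun y => L a (k • y))
    (hAst : ∀ (k : G) (a : Y → ℚ), a ∈ A → (fun y => a (k • y)) ∈ A)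
    (hAirr : ∀ W : Submodule ℚ (Y → ℚ), W ≤ A → W ≠ ⊥ →
      (∀ (k : G) (f : Y → ℚ), f ∈ W → (fun y => f (k • y)) ∈ W) → W = A)
    (ι₀ : (Y → ℚ) →ₗ[ℚ] (E i₀ → ℚ)) (ι₁ : (Y → ℚ) →ₗ[ℚ] (E i₁ → ℚ))
    (hι₀eq : ∀ (k : G) (a : Y → ℚ), a ∈ A → ι₀ (fun y => a (k • y)) = fun y => ι₀ a (k • y))
    (hι₁eq : ∀ (k : G) (a : Y → ℚ), a ∈ A → ι₁ (fun y => a (k • y)) = fun y => ι₁ a (k • y))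
    (hinj₀ : ∀ f ∈ A, ι₀ f = 0 → f = 0) (hinj₁ : ∀ f ∈ A, ι₁ f = 0 → f = 0)
    {b₀ b₁ : Y → ℚ} (hb₀ : b₀ ∈ A) (hb₁ : b₁ ∈ A) (hb₀0 : b₀ ≠ 0) (hb₁0 : b₁ ≠ 0)
    (hu₀ : antiVec (Φ i₀) (1 : G) = ι₀ b₀) (hu₁ : antiVec (Φ i₁) (1 : G) = ι₁ b₁) :
    typeRank G (sigmaType Φ) = typeRank G (Φ i₀) ↔ typeRank G (sigmaType Φ) = typeRank G (Φ i₁) := by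
  have hI' : ∀ j, j = i₁ ∨ j = i₀ := fun j => (hI j).symm
  rw [typeRank_sigmaType_eq_typeRank_iff_span_coeff_le_of_pair h hI,
    typeRank_sigmaType_eq_typeRank_iff_span_coeff_le_of_pair h hI',
    span_coeff_le_iff_span_coeff_eq_single Φ i₀ i₁ h𝒟 hAst hAirr ι₀ ι₁ hι₀eq hι₁eq hinj₀ hinj₁ hb₀ hb₁ hb₀0 hb₁0
      hu₀ hu₁,
    span_coeff_le_iff_span_coeff_eq_single Φ i₁ i₀ h𝒟 hAst hAirr ι₁ ι₀ hι₁eq hι₀eq hinj₁ hinj₀ hb₁ hb₀ hb₁0 hb₀0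
      hu₁ hu₀, eq_comm]

end Class

end Summit.HodgeConjecture.CorCM.IrrOdd

end
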